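import Summits.QuantumFields.YangMills.Theorems.RecentredCoverTransferCellTranslation
import HarnessLib

/-!
# The multilinear RECENTRING EXPANSION of the centred cell moments and of the cell `n`-point distribution
# (kit for crux `CoverRecentring`, route `RecentredCoverTransfer`, stmt-QuantumFields-23105, LINE g9-A/B of planner ym-idea-1 g9)

Helper file (`--supports stmt-QuantumFields-23105 --as helper`; width seat `ym-line-sfw-p2-w3` g28 of cell ym-idea-1, free hands).
Route-independent (imports only the sibling kit `Theorems/RecentredCoverTransferCellTranslation`), definition-free, 0 sorry.  It types the tool the route thesis names for `n ≥ 3`: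
«`CoverRecentring ⇐ MeanShiftSubQuartic → CoverMomentCeilings` by the multilinear expansion
`∏ᵢ ((dᵢ − μ) + Δ) = Σ_S Δ^(n−|S|) ∏_{i∈S} (dᵢ − μ)`», for ANY period cell `C` of `ℤᵈ` (`Theorems.ROT.PeriodCell`), any bounded
measurable observable `O`, any two additive normalisations `m, μ` (`Δ = μ − m`):

* §1 `prod_sub_eq_sum_powerset` — the ring identity `∏_{i∈s} (aᵢ − m) = Σ_{S ⊆ s} (μ − m)^(|s|−|S|) · ∏_{i∈S} (aᵢ − μ)`
  (`Finset.prod_add`);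
* §2 ★ `moment_eq_sum_powerset` — `W_m(x₁,…,xₙ) = Σ_{S ⊆ [n]} (μ − m)^(n−|S|) · E_C[∏_{i∈S} (O(τ_{xᵢ}Ũ) − μ)]` (sum and integral
  commute: every partial product is bounded and measurable, `integrable_partialProd_obs`);
* §3 ★ `dist_eq_sum_powerset` — the same on test functions, `dist_C(A; m) F = Σ_S (μ − m)^(n−|S|) · Σ_{x∈repsⁿ} W^S_μ(x) F(A x)`, and
  ★ `dist_sub_dist_eq_sum_ssubsets` — the `S = [n]` term is `dist_C(A; μ) F`, so
  `dist_C(A; m) F − dist_C(A; μ) F = Σ_{S ⊊ [n]} (μ − m)^(n−|S|) · Σ_x W^S_μ(x) F(A x)`: every term carries at least one power of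
  `Δ = μ − m`.  With `μ = m_C` (the cell's own mean) the `|S| = n − 1` terms vanish as well (`Theorems/RecentredCoverTransferCellTranslation`,
  `integral_obs_shift_lift_eq_mean`), and with `m = m_T` the torus mean this is the currency in which `CoverRecentring` is to be fed by
  `Δ_k = o(a_k⁴)` and `2n`-point ceilings on the cover.

HONEST FRAMING: the cruxes `CoverRecentring` (23105) / `CommonCentredCoverTransfer` (23106) stay OPEN; no item is closed; no summit,
rung (R2d ROT is a RECORD rung) or mass gap is proved.  References: standard (multilinear expansion of centred moments / cumulant
bookkeeping), e.g. Glimm–Jaffe, Quantum Physics (1987) §6.1.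
-/

set_option autoImplicit false

noncomputable section

open scoped SchwartzMap BigOperators ENNReal
open MeasureTheory Filter Topology
open Literature.MathematicalPhysics.QuantumFieldTheory Literature.MathematicalPhysics.QuantumLattice
open Literature.MathematicalPhysics.AQFT
open Literature.Probability.LatticeModels (Site)
open Summit.QuantumFields.YangMills.Theorems.ROT (PeriodCell)

namespace Summit.QuantumFields.YangMills.Theorems.RecentredCoverTransfer

/-! ## §1 The ring identity -/

/-- **Recentring a product**: `∏_{i∈s} (aᵢ − m) = Σ_{S ⊆ s} (μ − m)^(|s|−|S|) · ∏_{i∈S} (aᵢ − μ)` in any commutative ring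
(write `aᵢ − m = (aᵢ − μ) + (μ − m)` and expand, `Finset.prod_add`). [folklore] -/
theorem prod_sub_eq_sum_powerset {ι R : Type*} [CommRing R] [DecidableEq ι] (a : ι → R) (m μ : R) (s : Finset ι) :
    ∏ i ∈ s, (a i - m) = ∑ S ∈ s.powerset, (μ - m) ^ (s.card - S.card) * ∏ i ∈ S, (a i - μ) := by
  have h : ∀ i, a i - m = (a i - μ) + (μ - m) := fun i => by ring
  simp_rw [h]
  rw [Finset.prod_add]
  refine Finset.sum_congr rfl fun S hS => ?_
  rw [Finset.prod_const, Finset.card_sdiff_of_subset (Finset.mem_powerset.1 hS), mul_comm]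

/-! ## §2 The centred cell moments -/

section Moments

variable {d : ℕ} (C : PeriodCell d) {G : Type*} [Group G] {N : ℕ} (ρ : G →* Matrix (Fin N) (Fin N) ℂ)
  [TopologicalSpace G] [IsTopologicalGroup G] [CompactSpace G] [MeasurableSpace G] [BorelSpace G]

/-- Every PARTIAL centred product `∏_{i∈S} (O(τ_{xᵢ}Ũ) − μ)` of a bounded measurable observable is integrable for Wilson's
(probability) law on the cell. [folklore] -/
theorem integrable_partialProd_obs (hρ : Continuous ρ) (β : ℝ) {O : LGConfig d G → ℝ} (hO : Measurable O) {B : ℝ}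
    (hB : ∀ V, |O V| ≤ B) (μ : ℝ) {n : ℕ} (x : Fin n → Site d) (S : Finset (Fin n)) :
    Integrable (fun U : C.Config G => ∏ i ∈ S, (O (configShift (-(x i)) (C.lift U)) - μ)) (C.measure ρ β) := by
  haveI := C.isProbabilityMeasure_measure ρ hρ β
  have hmeas : ∀ i, Measurable fun U : C.Config G => O (configShift (-(x i)) (C.lift U)) - μ := fun i =>
    (hO.comp ((configShift _).measurable.comp (measurable_cellLift C))).sub measurable_const
  refine Integrable.of_bound (Finset.measurable_prod _ fun i _ => hmeas i).aestronglyMeasurable ((|B| + |μ|) ^ S.card) ?_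
  refine Eventually.of_forall fun U => ?_
  rw [Real.norm_eq_abs, Finset.abs_prod]
  calc ∏ i ∈ S, |O (configShift (-(x i)) (C.lift U)) - μ|
      ≤ ∏ _i ∈ S, (|B| + |μ|) := Finset.prod_le_prod (fun _ _ => abs_nonneg _) fun i _ =>
        (abs_sub _ _).trans (add_le_add ((hB _).trans (le_abs_self B)) le_rfl)
    _ = (|B| + |μ|) ^ S.card := Finset.prod_const _

/-- ★ **Multilinear recentring expansion of the centred cell moments**: for any two additive normalisations `m, μ`,
`W_m(x₁,…,xₙ) = Σ_{S ⊆ [n]} (μ − m)^(n−|S|) · ∫ ∏_{i∈S} (O(τ_{xᵢ}Ũ) − μ) dμ_C`. [folklore] -/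
theorem moment_eq_sum_powerset (hρ : Continuous ρ) (β : ℝ) {O : LGConfig d G → ℝ} (hO : Measurable O) {B : ℝ}
    (hB : ∀ V, |O V| ≤ B) (m μ : ℝ) {n : ℕ} (x : Fin n → Site d) :
    C.moment ρ β O m x =
      ∑ S ∈ (Finset.univ : Finset (Fin n)).powerset,
        (μ - m) ^ (n - S.card) * ∫ U, ∏ i ∈ S, (O (configShift (-(x i)) (C.lift U)) - μ) ∂(C.measure ρ β) := by
  unfold PeriodCell.moment
  have hpt : ∀ U : C.Config G, ∏ i, (O (configShift (-(x i)) (C.lift U)) - m) =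
      ∑ S ∈ (Finset.univ : Finset (Fin n)).powerset,
        (μ - m) ^ (n - S.card) * ∏ i ∈ S, (O (configShift (-(x i)) (C.lift U)) - μ) := fun U => by
    rw [prod_sub_eq_sum_powerset (fun i => O (configShift (-(x i)) (C.lift U))) m μ Finset.univ, Finset.card_univ,
      Fintype.card_fin]
  simp_rw [hpt]
  rw [integral_finsetSum _ fun S _ => (integrable_partialProd_obs C ρ hρ β hO hB μ x S).const_mul _]
  refine Finset.sum_congr rfl fun S _ => ?_
  rw [integral_const_mul]

/-! ## §3 The cell `n`-point distribution -/

/-- ★ **Recentring expansion on test functions**: for every site embedding `A` and test function `F`,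
`dist_C(A; m) F = Σ_{S ⊆ [n]} (μ − m)^(n−|S|) · Σ_{x ∈ repsⁿ} (∫ ∏_{i∈S} (O(τ_{xᵢ}Ũ) − μ) dμ_C) · F(A x)`. [folklore] -/
theorem dist_eq_sum_powerset (hρ : Continuous ρ) (β : ℝ) (A : Site d → EuclideanSpace ℝ (Fin d)) {O : LGConfig d G → ℝ}
    (hO : Measurable O) {B : ℝ} (hB : ∀ V, |O V| ≤ B) (m μ : ℝ) (n : ℕ) (F : 𝓢((Fin n → EuclideanSpace ℝ (Fin d)), ℂ)) :
    C.dist ρ β A O m n F =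
      ∑ S ∈ (Finset.univ : Finset (Fin n)).powerset, (((μ - m) ^ (n - S.card) : ℝ) : ℂ) *
        ∑ x ∈ Fintype.piFinset (fun _ : Fin n => C.reps),
          ((∫ U, ∏ i ∈ S, (O (configShift (-(x i)) (C.lift U)) - μ) ∂(C.measure ρ β) : ℝ) : ℂ) * F (fun i => A (x i)) := by
  rw [PeriodCell.dist_apply]
  simp_rw [moment_eq_sum_powerset C ρ hρ β hO hB m μ, Complex.ofReal_sum, Complex.ofReal_mul, Complex.ofReal_pow,
    Finset.sum_mul, Finset.mul_sum]
  rw [Finset.sum_comm]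
  refine Finset.sum_congr rfl fun S _ => Finset.sum_congr rfl fun x _ => ?_
  ring

/-- The `S = [n]` term of the expansion is the distribution centred at `μ`. [folklore] -/
theorem dist_eq_sum_univ_term (β : ℝ) (A : Site d → EuclideanSpace ℝ (Fin d)) (O : LGConfig d G → ℝ) (μ : ℝ) (n : ℕ)
    (F : 𝓢((Fin n → EuclideanSpace ℝ (Fin d)), ℂ)) :
    C.dist ρ β A O μ n F =
      ∑ x ∈ Fintype.piFinset (fun _ : Fin n => C.reps),
        ((∫ U, ∏ i ∈ (Finset.univ : Finset (Fin n)), (O (configShift (-(x i)) (C.lift U)) - μ) ∂(C.measure ρ β) : ℝ) : ℂ) *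
          F (fun i => A (x i)) := by
  rw [PeriodCell.dist_apply]
  rfl

/-- ★ **The recentring difference is a sum over PROPER subsets**: `dist_C(A; m) F − dist_C(A; μ) F =
Σ_{S ⊊ [n]} (μ − m)^(n−|S|) · Σ_{x ∈ repsⁿ} W^S_μ(x) F(A x)` — every term carries a positive power of `μ − m`. [folklore] -/
theorem dist_sub_dist_eq_sum_ssubsets (hρ : Continuous ρ) (β : ℝ) (A : Site d → EuclideanSpace ℝ (Fin d))
    {O : LGConfig d G → ℝ} (hO : Measurable O) {B : ℝ} (hB : ∀ V, |O V| ≤ B) (m μ : ℝ) (n : ℕ)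
    (F : 𝓢((Fin n → EuclideanSpace ℝ (Fin d)), ℂ)) :
    C.dist ρ β A O m n F - C.dist ρ β A O μ n F =
      ∑ S ∈ ((Finset.univ : Finset (Fin n)).powerset).erase Finset.univ, (((μ - m) ^ (n - S.card) : ℝ) : ℂ) *
        ∑ x ∈ Fintype.piFinset (fun _ : Fin n => C.reps),
          ((∫ U, ∏ i ∈ S, (O (configShift (-(x i)) (C.lift U)) - μ) ∂(C.measure ρ β) : ℝ) : ℂ) * F (fun i => A (x i)) := by
  rw [dist_eq_sum_powerset C ρ hρ β A hO hB m μ n F, sub_eq_iff_eq_add,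
    ← Finset.sum_erase_add _ _ (Finset.mem_powerset.2 (Finset.Subset.refl (Finset.univ : Finset (Fin n)))),
    dist_eq_sum_univ_term C ρ β A O μ n F]
  congr 1
  rw [Finset.card_univ, Fintype.card_fin, Nat.sub_self, pow_zero, Complex.ofReal_one, one_mul]

/-- In every proper-subset term the power of `μ − m` is POSITIVE: `1 ≤ n − |S|` for `S ⊊ [n]`. [folklore] -/
theorem one_le_sub_card_of_mem_erase {n : ℕ} {S : Finset (Fin n)}
    (hS : S ∈ ((Finset.univ : Finset (Fin n)).powerset).erase Finset.univ) : 1 ≤ n - S.card := by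
  obtain ⟨hne, -⟩ := Finset.mem_erase.1 hS
  have hlt : S.card < n := by
    have h := Finset.card_lt_card (Finset.ssubset_univ_iff.2 hne)
    rwa [Finset.card_univ, Fintype.card_fin] at h
  omega

end Moments

end Summit.QuantumFields.YangMills.Theorems.RecentredCoverTransfer

end
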